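import Summits.CriticalPhenomena.PercolationContinuityZ3.Theorems.PercNearOneGluingNoHeavyLowerTailSahiOneStepLayerMonotone
import HarnessLib

/-!
# One-step scheme, `(2′)` half at uniform density — two fibrewise layer inequalities for MONO-A

Support file (prover prim-ineq-prove-3 gen 21; `--supports stmt-CriticalPhenomena-4575`; memo
`run/shared/lean/prim/prim-ineq-prove-3/PROOF-2PRIME-UNIFORM.md`, Lemma 6, steps (ii) and (T5)).  No definitions, no named facts, no sorries,
no `native_decide`.  Both results are proved for an ARBITRARY product measure by the two-copy fibre criterion `real_mul_real_le_of_fibre2` (gen 18).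

* `card_le_card_of_erase_mem` — the mirror-layer double count: if `|D| = 2a+1`, `𝒢 ⊆ 2^D` consists of `(a+1)`-sets and every one-point deletion
  of a member of `𝒢` lies in the family `𝒮` of `a`-sets, then `#𝒢 ≤ #𝒮`.
* **`real_shadow_layer_mul_le`** (memo Lemma 6 (ii), "the density of `A¹` at level `k` is at least the density of `A⁰` at level `k+1`"): if every
  one-point deletion (inside `F`) of a member of `A₀` lies in `A₁` (both `F`-determined), then
  `μ(A₀ ∩ {N_F = k+1})·μ{N_F = k} ≤ μ(A₁ ∩ {N_F = k})·μ{N_F = k+1}`.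
* **`real_layer_logConcave`** (tool (T5), log-concavity of the law of `N_F = #(F ∩ ω)`): `μ{N_F = a}·μ{N_F = b+1} ≤ μ{N_F = a+1}·μ{N_F = b}` for
  `a < b` (fibrewise: `C(d,α) ≤ C(d,α+1)` below the middle, `Nat.choose_le_succ_of_lt_half_left`).
-/

noncomputable section

namespace Summit.CriticalPhenomena.PercolationContinuityZ3.Theorems

namespace SahiOneStep

open MeasureTheory Finset
open Literature.Probability.Percolation (DeterminedBy determinedBy_iff)
open Literature.Probability.LatticeModels (prodBernoulli)
open Literature.Probability.Percolation.DecisionTree (ind ind_of_mem ind_of_not_mem)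
open scoped Classical

variable {ι : Type*} [Fintype ι] [DecidableEq ι]

/-! ## The mirror-layer double count -/

omit [Fintype ι] in
/-- **Mirror-layer double count.**  If `#D = 2a+1`, every member of `𝒢` is an `(a+1)`-subset of `D` all of whose one-point deletions lie in `𝒮`,
and `𝒮` consists of `a`-sets, then `#𝒢 ≤ #𝒮` (count the pairs `S ⊂ T`: each `T ∈ 𝒢` has `a+1` deletions, each `S ∈ 𝒮` at most `#(D ∖ S) = a+1`
extensions). [folklore] -/
theorem card_le_card_of_erase_mem (D : Finset ι) (a : ℕ) (hD : D.card = 2 * a + 1) (𝒢 𝒮 : Finset (Finset ι))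
    (h𝒢 : ∀ T ∈ 𝒢, T ⊆ D ∧ T.card = a + 1) (h𝒮 : ∀ S ∈ 𝒮, S ⊆ D ∧ S.card = a) (hdel : ∀ T ∈ 𝒢, ∀ x ∈ T, T.erase x ∈ 𝒮) :
    #𝒢 ≤ #𝒮 := by
  have key : #𝒢 * (a + 1) ≤ #𝒮 * (a + 1) := by
    refine Finset.card_mul_le_card_mul (fun T S => S ⊆ T) (fun T hT => ?_) (fun S hS => ?_)
    · -- at least `a+1` deletions
      obtain ⟨_, hTc⟩ := h𝒢 T hT
      rw [← hTc]
      refine Finset.card_le_card_of_injOn (fun x => T.erase x) (fun x hx => ?_) (fun x hx x' hx' h => ?_)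
      · rw [Finset.mem_coe] at hx
        rw [Finset.mem_coe, Finset.mem_bipartiteAbove]
        exact ⟨hdel T hT x hx, Finset.erase_subset x T⟩
      · rw [Finset.mem_coe] at hx hx'
        by_contra hne
        have : x ∈ T.erase x' := Finset.mem_erase.2 ⟨hne, hx⟩
        have h' : T.erase x = T.erase x' := h
        rw [← h'] at this
        exact (Finset.mem_erase.1 this).1 rfl
    · -- at most `#(D ∖ S) = a+1` extensions
      obtain ⟨hSD, hSc⟩ := h𝒮 S hS
      calc #(Finset.bipartiteBelow (fun T S' => S' ⊆ T) 𝒢 S)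
          ≤ #((D \ S).image fun x => insert x S) := by
            refine Finset.card_le_card fun T hT => ?_
            rw [Finset.mem_bipartiteBelow] at hT
            obtain ⟨hTD, hTc⟩ := h𝒢 T hT.1
            have hsd : (T \ S).card = 1 := by rw [Finset.card_sdiff_of_subset hT.2, hTc, hSc]; omega
            obtain ⟨x, hx⟩ := Finset.card_eq_one.1 hsd
            have hxT : x ∈ T \ S := by rw [hx]; exact Finset.mem_singleton_self x
            rw [Finset.mem_sdiff] at hxT
            refine Finset.mem_image.2 ⟨x, Finset.mem_sdiff.2 ⟨hTD hxT.1, hxT.2⟩, ?_⟩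
            ext y
            rw [Finset.mem_insert]
            constructor
            · rintro (rfl | hy)
              · exact hxT.1
              · exact hT.2 hy
            · intro hy
              by_cases hyS : y ∈ S
              · exact Or.inr hyS
              · have : y ∈ T \ S := Finset.mem_sdiff.2 ⟨hy, hyS⟩
                rw [hx, Finset.mem_singleton] at this
                exact Or.inl this
        _ ≤ #(D \ S) := Finset.card_image_le
        _ = a + 1 := by rw [Finset.card_sdiff_of_subset hSD, hD, hSc]; omega
  exact Nat.le_of_mul_le_mul_right key (Nat.succ_pos a)

/-! ## Fibrewise counting helpers -/

omit [Fintype ι] in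
/-- On a fibre `(I, D = J ∖ I)`: a pattern sum of `1_X(I ∪ R)·[P(#R)]` is a filtered count. [folklore] -/
theorem sum_ind_pat_mul_ite_eq_card (X : Set (Set ι)) (I D : Finset ι) (P : ℕ → Prop) [DecidablePred P] :
    ∑ R ∈ D.powerset, ind (pat X) (I ∪ R) * (if P R.card then (1 : ℝ) else 0) =
      #((D.powerset.filter fun R => ((↑(I ∪ R) : Set ι)) ∈ X).filter fun R => P R.card) := by
  rw [Finset.card_eq_sum_ones, Finset.sum_filter, Finset.sum_filter, Nat.cast_sum]
  refine Finset.sum_congr rfl fun R _ => ?_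
  by_cases hRB : ((↑(I ∪ R) : Set ι)) ∈ X
  · rw [ind_of_mem (mem_pat.2 hRB), one_mul, if_pos hRB]
    by_cases hP : P R.card <;> simp [hP]
  · rw [ind_of_not_mem (fun h => hRB (mem_pat.1 h)), zero_mul, if_neg hRB, Nat.cast_zero]

/-! ## The shadow inequality between consecutive layers -/

omit [Fintype ι] in
/-- **Shadow inequality** (memo Lemma 6 (ii)): if every one-point deletion inside `F` of a member of `A₀` lies in `A₁` (both `F`-determined), then
`μ(A₀ ∩ {N_F = k+1})·μ{N_F = k} ≤ μ(A₁ ∩ {N_F = k})·μ{N_F = k+1}` — the density of `A₁` at level `k` is at least the density of `A₀` at level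
`k+1`.  Fibrewise this is the mirror-layer double count `card_le_card_of_erase_mem`. [this work] -/
theorem real_shadow_layer_mul_le (p : ι → unitInterval) (F : Finset ι) {A₀ A₁ : Set (Set ι)}
    (hA₀F : DeterminedBy A₀ (↑F : Set ι)) (hA₁F : DeterminedBy A₁ (↑F : Set ι))
    (hdel : ∀ ω ∈ A₀, ∀ j ∈ F, j ∈ ω → ω \ {j} ∈ A₁) (k : ℕ) :
    (prodBernoulli p).real (A₀ ∩ {ω : Set ι | (F.filter (· ∈ ω)).card = k + 1}) *
        (prodBernoulli p).real {ω : Set ι | (F.filter (· ∈ ω)).card = k} ≤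
      (prodBernoulli p).real (A₁ ∩ {ω : Set ι | (F.filter (· ∈ ω)).card = k}) *
        (prodBernoulli p).real {ω : Set ι | (F.filter (· ∈ ω)).card = k + 1} := by
  refine real_mul_real_le_of_fibre2 p (hA₁F.inter (determinedBy_layer F k)) (determinedBy_layer F (k + 1))
    (hA₀F.inter (determinedBy_layer F (k + 1))) (determinedBy_layer F k) fun I J hIJ hJF => ?_
  set D := J \ I with hD
  have hID : Disjoint I D := Finset.disjoint_sdiff
  have hIF : I ⊆ F := hIJ.trans hJF
  have memD : ∀ R ∈ D.powerset, R ⊆ D := fun R hR => Finset.mem_powerset.1 hR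
  have cardIR : ∀ R ∈ D.powerset, (I ∪ R).card = I.card + R.card := fun R hR =>
    Finset.card_union_of_disjoint (hID.mono_right (memD R hR))
  have cardJR : ∀ R ∈ D.powerset, (J \ R).card = J.card - R.card := fun R hR =>
    Finset.card_sdiff_of_subset ((memD R hR).trans Finset.sdiff_subset)
  have subIR : ∀ R ∈ D.powerset, I ∪ R ⊆ F := fun R hR =>
    Finset.union_subset hIF (((memD R hR).trans Finset.sdiff_subset).trans hJF)
  have subJR : ∀ R ∈ D.powerset, J \ R ⊆ F := fun R _ => Finset.sdiff_subset.trans hJF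
  have hJcard : J.card = I.card + D.card := by
    have := Finset.card_le_card hIJ
    rw [hD, Finset.card_sdiff_of_subset hIJ]; omega
  have lhs_eq : ∀ R ∈ D.powerset,
      ind (pat (A₀ ∩ {ω : Set ι | (F.filter (· ∈ ω)).card = k + 1})) (I ∪ R) * ind (pat {ω : Set ι | (F.filter (· ∈ ω)).card = k}) (J \ R) =
        ind (pat A₀) (I ∪ R) * (if I.card + R.card = k + 1 ∧ J.card - R.card = k then 1 else 0) := by
    intro R hR
    rw [ind_pat_inter_layer F A₀ (k + 1) (subIR R hR), ind_pat_layer F k (subJR R hR), cardIR R hR, cardJR R hR]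
    by_cases h1 : I.card + R.card = k + 1 <;> by_cases h2 : J.card - R.card = k <;> simp [h1, h2]
  have rhs_eq : ∀ R ∈ D.powerset,
      ind (pat (A₁ ∩ {ω : Set ι | (F.filter (· ∈ ω)).card = k})) (I ∪ R) * ind (pat {ω : Set ι | (F.filter (· ∈ ω)).card = k + 1}) (J \ R) =
        ind (pat A₁) (I ∪ R) * (if I.card + R.card = k ∧ J.card - R.card = k + 1 then 1 else 0) := by
    intro R hR
    rw [ind_pat_inter_layer F A₁ k (subIR R hR), ind_pat_layer F (k + 1) (subJR R hR), cardIR R hR, cardJR R hR]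
    by_cases h1 : I.card + R.card = k <;> by_cases h2 : J.card - R.card = k + 1 <;> simp [h1, h2]
  rw [Finset.sum_congr rfl lhs_eq, Finset.sum_congr rfl rhs_eq,
    sum_ind_pat_mul_ite_eq_card A₀ I D (fun r => I.card + r = k + 1 ∧ J.card - r = k),
    sum_ind_pat_mul_ite_eq_card A₁ I D (fun r => I.card + r = k ∧ J.card - r = k + 1)]
  set 𝒰₀ := D.powerset.filter (fun R => ((↑(I ∪ R) : Set ι)) ∈ A₀) with h𝒰₀
  set 𝒰₁ := D.powerset.filter (fun R => ((↑(I ∪ R) : Set ι)) ∈ A₁) with h𝒰₁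
  by_cases hP : I.card ≤ k ∧ D.card = 2 * (k - I.card) + 1
  · obtain ⟨hik, hDc⟩ := hP
    have e0 : (𝒰₀.filter fun R => I.card + R.card = k + 1 ∧ J.card - R.card = k) = 𝒰₀.filter fun R => R.card = (k - I.card) + 1 := by
      refine Finset.filter_congr fun R hR => ?_
      have hRD := Finset.card_le_card (Finset.mem_powerset.1 (Finset.mem_filter.1 hR).1)
      constructor
      · rintro ⟨h1, _⟩; omega
      · intro h; constructor <;> omega
    have e1 : (𝒰₁.filter fun R => I.card + R.card = k ∧ J.card - R.card = k + 1) = 𝒰₁.filter fun R => R.card = k - I.card := by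
      refine Finset.filter_congr fun R hR => ?_
      have hRD := Finset.card_le_card (Finset.mem_powerset.1 (Finset.mem_filter.1 hR).1)
      constructor
      · rintro ⟨h1, _⟩; omega
      · intro h; constructor <;> omega
    rw [e0, e1]
    exact_mod_cast card_le_card_of_erase_mem D (k - I.card) hDc _ _
      (fun T hT => by
        rw [Finset.mem_filter, h𝒰₀, Finset.mem_filter, Finset.mem_powerset] at hT
        exact ⟨hT.1.1, hT.2⟩)
      (fun S hS => by
        rw [Finset.mem_filter, h𝒰₁, Finset.mem_filter, Finset.mem_powerset] at hS
        exact ⟨hS.1.1, hS.2⟩)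
      (fun T hT x hx => by
        rw [Finset.mem_filter, h𝒰₀, Finset.mem_filter, Finset.mem_powerset] at hT
        rw [Finset.mem_filter, h𝒰₁, Finset.mem_filter, Finset.mem_powerset]
        refine ⟨⟨(Finset.erase_subset x T).trans hT.1.1, ?_⟩, ?_⟩
        · have hxI : x ∉ I := fun hxI => Finset.disjoint_left.1 hID hxI (hT.1.1 hx)
          have hxF : x ∈ F := ((hT.1.1.trans Finset.sdiff_subset).trans hJF) hx
          have h := hdel _ hT.1.2 x hxF (by rw [Finset.coe_union]; exact Or.inr hx)
          have hset : ((↑(I ∪ T) : Set ι)) \ {x} = ↑(I ∪ T.erase x) := by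
            ext y
            simp only [Finset.coe_union, Finset.coe_erase, Set.mem_sdiff, Set.mem_union, Finset.mem_coe, Set.mem_singleton_iff]
            constructor
            · rintro ⟨hy | hy, hyx⟩
              · exact Or.inl hy
              · exact Or.inr ⟨hy, hyx⟩
            · rintro (hy | ⟨hy, hyx⟩)
              · exact ⟨Or.inl hy, fun hyx => hxI (hyx ▸ hy)⟩
              · exact ⟨Or.inr hy, hyx⟩
          rw [hset] at h
          exact h
        · rw [Finset.card_erase_of_mem hx, hT.2]; omega)
  · have e0 : (𝒰₀.filter fun R => I.card + R.card = k + 1 ∧ J.card - R.card = k) = ∅ := by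
      rw [Finset.filter_eq_empty_iff]
      intro R hR ⟨h1, h2⟩
      have hRD := Finset.card_le_card (Finset.mem_powerset.1 (Finset.mem_filter.1 hR).1)
      apply hP; constructor <;> omega
    rw [e0, Finset.card_empty, Nat.cast_zero]
    exact Nat.cast_nonneg _

/-! ## Log-concavity of the layer law -/

omit [Fintype ι] in
/-- **Log-concavity of `N_F`** (tool (T5)): `μ{N_F = a}·μ{N_F = b+1} ≤ μ{N_F = a+1}·μ{N_F = b}` for `a < b` — fibrewise the monotonicity of
binomial coefficients below the middle. [folklore; this proof] -/
theorem real_layer_logConcave (p : ι → unitInterval) (F : Finset ι) {a b : ℕ} (hab : a < b) :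
    (prodBernoulli p).real {ω : Set ι | (F.filter (· ∈ ω)).card = a} *
        (prodBernoulli p).real {ω : Set ι | (F.filter (· ∈ ω)).card = b + 1} ≤
      (prodBernoulli p).real {ω : Set ι | (F.filter (· ∈ ω)).card = a + 1} *
        (prodBernoulli p).real {ω : Set ι | (F.filter (· ∈ ω)).card = b} := by
  refine real_mul_real_le_of_fibre2 p (determinedBy_layer F (a + 1)) (determinedBy_layer F b)
    (determinedBy_layer F a) (determinedBy_layer F (b + 1)) fun I J hIJ hJF => ?_
  set D := J \ I with hD
  have hID : Disjoint I D := Finset.disjoint_sdiff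
  have hIF : I ⊆ F := hIJ.trans hJF
  have memD : ∀ R ∈ D.powerset, R ⊆ D := fun R hR => Finset.mem_powerset.1 hR
  have cardIR : ∀ R ∈ D.powerset, (I ∪ R).card = I.card + R.card := fun R hR =>
    Finset.card_union_of_disjoint (hID.mono_right (memD R hR))
  have cardJR : ∀ R ∈ D.powerset, (J \ R).card = J.card - R.card := fun R hR =>
    Finset.card_sdiff_of_subset ((memD R hR).trans Finset.sdiff_subset)
  have subIR : ∀ R ∈ D.powerset, I ∪ R ⊆ F := fun R hR =>
    Finset.union_subset hIF (((memD R hR).trans Finset.sdiff_subset).trans hJF)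
  have subJR : ∀ R ∈ D.powerset, J \ R ⊆ F := fun R _ => Finset.sdiff_subset.trans hJF
  have hJcard : J.card = I.card + D.card := by
    have := Finset.card_le_card hIJ
    rw [hD, Finset.card_sdiff_of_subset hIJ]; omega
  -- both sums are counts of subsets of `D` of a fixed size
  have count : ∀ (u v : ℕ), ∑ R ∈ D.powerset, ind (pat {ω : Set ι | (F.filter (· ∈ ω)).card = u}) (I ∪ R) *
      ind (pat {ω : Set ι | (F.filter (· ∈ ω)).card = v}) (J \ R) =
      #(D.powerset.filter fun R => I.card + R.card = u ∧ J.card - R.card = v) := by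
    intro u v
    rw [Finset.card_eq_sum_ones, Finset.sum_filter, Nat.cast_sum]
    refine Finset.sum_congr rfl fun R hR => ?_
    rw [ind_pat_layer F u (subIR R hR), ind_pat_layer F v (subJR R hR), cardIR R hR, cardJR R hR]
    by_cases h1 : I.card + R.card = u <;> by_cases h2 : J.card - R.card = v <;> simp [h1, h2]
  rw [count, count]
  by_cases hP : I.card ≤ a ∧ D.card = (a - I.card) + (b - I.card) + 1
  · obtain ⟨hia, hDc⟩ := hP
    have e0 : (D.powerset.filter fun R => I.card + R.card = a ∧ J.card - R.card = b + 1) = D.powersetCard (a - I.card) := by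
      ext R
      rw [Finset.mem_filter, Finset.mem_powersetCard, Finset.mem_powerset]
      constructor
      · rintro ⟨hR, h1, _⟩; exact ⟨hR, by omega⟩
      · rintro ⟨hR, h⟩
        have hRD := Finset.card_le_card hR
        exact ⟨hR, by omega, by omega⟩
    have e1 : (D.powerset.filter fun R => I.card + R.card = a + 1 ∧ J.card - R.card = b) = D.powersetCard (a - I.card + 1) := by
      ext R
      rw [Finset.mem_filter, Finset.mem_powersetCard, Finset.mem_powerset]
      constructor
      · rintro ⟨hR, h1, _⟩; exact ⟨hR, by omega⟩
      · rintro ⟨hR, h⟩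
        have hRD := Finset.card_le_card hR
        exact ⟨hR, by omega, by omega⟩
    rw [e0, e1, Finset.card_powersetCard, Finset.card_powersetCard]
    exact_mod_cast Nat.choose_le_succ_of_lt_half_left (by omega)
  · have e0 : (D.powerset.filter fun R => I.card + R.card = a ∧ J.card - R.card = b + 1) = ∅ := by
      rw [Finset.filter_eq_empty_iff]
      intro R hR ⟨h1, h2⟩
      have hRD := Finset.card_le_card (Finset.mem_powerset.1 hR)
      apply hP; constructor <;> omega
    rw [e0, Finset.card_empty, Nat.cast_zero]
    exact Nat.cast_nonneg _

end SahiOneStep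

end Summit.CriticalPhenomena.PercolationContinuityZ3.Theorems
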